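import Summits.AnomalousDissipation.AnomalousDissipation.Theorems.SawtoothPulseCascadeK1LocalisedCascadeKHCreationAtoms

/-!
# K2 lane (route-2 `SawtoothPulseCascade`, crux dir `K1LocalisedCascade`): the twelve-term creation bound as a NUMBER — `cos` entry, kink line `¼`

Helper file of the K2 lane (ACL item stmt-AnomalousDissipation-19491; S2-cert forced part / P1″). For `a ≥ 1` and a block rate in the window
`0.55a ≤ ω ≤ πa/2 − 399/401` (`…KHStableDetuning`/`…KHStableRotation`), the twelve-term bound of `…KHSourceResponse` for the `cos` propagator entry and
the source at `y₀ = ¼` is at most **`0.163 / a ^ 2`** (`twelveTerm_cos_quarter_le`): term by term `height ≤ ε/((1−q)2κ)` with the decay factors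
`ε ∈ {1, 0.2237, 1/20, 0.0112, 1/400}` (`…KHCreationAtoms`), detuning `≤ 1.48` (kink phases) or `≤ 40/11` (frequency 0), coefficient `≤ 0.0654/a²`;
`Σ εD = 4.972`. §0 also carries the generic numeric lemmas (`detune_zero_le'`, `creation_coef_le` ≤ 0.0654/a², `termBound_le`, negative-offset heights). With `…KHComponentAssembly` and `…KHBlockEntries`: single-mode creation amplitude `O(1/a)` explicitly (crux `K2StableCreation.lean`).
No definitions; no statement about the crux. [folklore] [problem: turb]
-/

-- `Summit.<Summit>.<Problem>`: single-conjunct summit, the duplicate namespace segment is deliberate.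
set_option linter.dupNamespace false

noncomputable section

namespace Summit.AnomalousDissipation.AnomalousDissipation.Theorems.SawtoothPulseCascade.K2PhaseBudget

open Set Literature.Analysis.FluidPDE.SawtoothCascade

/-! ## §0 Generic numeric lemmas -/

/-- Frequency `0`, `a ≥ 1`: `1/|0 − ω| + 1/|0 + ω| ≤ 40/11`. [folklore] -/
theorem detune_zero_le' {a ω : ℝ} (ha : 1 ≤ a) (hlo : 0.55 * a ≤ ω) :
    1 / |(0 : ℝ) - ω| + 1 / |(0 : ℝ) + ω| ≤ 40 / 11 := by
  have h := detune_zero_le ha hlo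
  have ha0 : 0 < a := by linarith
  have : 40 / (11 * a) ≤ (40 : ℝ) / 11 := by
    rw [div_le_div_iff₀ (by positivity) (by norm_num)]; nlinarith
  linarith

/-- The common coefficient: `1/((1−q)·4πa) · (2+π)/(2πa) ≤ 0.0654/a²` for `a ≥ 1` (`q ≤ 1/400`, `3.141592 < π < 3.141593`). [folklore] -/
theorem creation_coef_le {a : ℝ} (ha : 1 ≤ a) :
    1 / ((1 - Real.exp (-(2 * Real.pi * a))) * (2 * (2 * Real.pi * a))) * (2 + Real.pi) / (2 * Real.pi * a) ≤ 0.0654 / a ^ 2 := by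
  have ha0 : 0 < a := by linarith
  have hq := exp_neg_kappa_le ha
  have hq0 : 0 < Real.exp (-(2 * Real.pi * a)) := Real.exp_pos _
  have hπ1 : (3.141592 : ℝ) < Real.pi := Real.pi_gt_d6
  have hπ2 : Real.pi < (3.141593 : ℝ) := Real.pi_lt_d6
  have hπsq : (9.8696 : ℝ) ≤ Real.pi ^ 2 := by nlinarith
  have h1q : (399 : ℝ) / 400 ≤ 1 - Real.exp (-(2 * Real.pi * a)) := by linarith
  have hden : (78.75 : ℝ) * a ^ 2 ≤ (1 - Real.exp (-(2 * Real.pi * a))) * (2 * (2 * Real.pi * a)) * (2 * Real.pi * a) := by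
    have e : (1 - Real.exp (-(2 * Real.pi * a))) * (2 * (2 * Real.pi * a)) * (2 * Real.pi * a) =
        (1 - Real.exp (-(2 * Real.pi * a))) * Real.pi ^ 2 * (8 * a ^ 2) := by ring
    rw [e]
    have := mul_le_mul h1q hπsq (by norm_num) (by linarith)
    nlinarith [sq_nonneg a]
  have hpos : 0 < (1 - Real.exp (-(2 * Real.pi * a))) * (2 * (2 * Real.pi * a)) * (2 * Real.pi * a) := by nlinarith [sq_nonneg a]
  rw [div_mul_eq_mul_div, one_mul, div_div, div_le_div_iff₀ hpos (by positivity)]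
  nlinarith [sq_nonneg a]

/-- **Per-term numeric bound:** `ε/((1−q)·4πa) · (2+π)/(2πa) · D · r ≤ 0.0654·ε·D·r/a²` (`a ≥ 1`; `ε, D, r ≥ 0`). [folklore] -/
theorem termBound_le {a : ℝ} (ha : 1 ≤ a) {ε D r : ℝ} (hε : 0 ≤ ε) (hD : 0 ≤ D) (hr : 0 ≤ r) :
    ε / ((1 - Real.exp (-(2 * Real.pi * a))) * (2 * (2 * Real.pi * a))) * (2 + Real.pi) / (2 * Real.pi * a) * D * r ≤
      0.0654 * ε * D * r / a ^ 2 := by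
  have h := creation_coef_le ha
  have e : ε / ((1 - Real.exp (-(2 * Real.pi * a))) * (2 * (2 * Real.pi * a))) * (2 + Real.pi) / (2 * Real.pi * a) * D * r =
      (1 / ((1 - Real.exp (-(2 * Real.pi * a))) * (2 * (2 * Real.pi * a))) * (2 + Real.pi) / (2 * Real.pi * a)) * (ε * D * r) := by ring
  rw [e, show 0.0654 * ε * D * r / a ^ 2 = (0.0654 / a ^ 2) * (ε * D * r) by ring]
  exact mul_le_mul_of_nonneg_right h (by positivity)

/-- `A`-type height with a NEGATIVE coefficient offset `−m` (the trough at `y₀ = −¼`): `‖P·A·e^{−κ(−m)}‖·e^{κy} ≤ ε/((1−q)·2κ)` when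
`e^{−κ(−m−y)} ≤ ε`. [folklore] -/
theorem heightA_neg_le {a : ℝ} (ha : 0 < a) (β : ℝ) {P : ℂ} (hP : ‖P‖ = 1) {m y ε : ℝ}
    (hε : Real.exp (-(2 * Real.pi * a) * (-m - y)) ≤ ε) :
    ‖P * (-1 / ((1 - starRingEnd ℂ (Complex.exp (2 * Real.pi * β * Complex.I)) * (Real.exp (-(2 * Real.pi * a)) : ℂ)) * (2 * (2 * Real.pi * a)))) *
        Complex.exp (-((2 * Real.pi * a : ℝ) : ℂ) * (-(m : ℂ)))‖ * Real.exp ((2 * Real.pi * a) * y) ≤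
      ε / ((1 - Real.exp (-(2 * Real.pi * a))) * (2 * (2 * Real.pi * a))) := by
  have h := heightA_le ha β hP (m := -m) (y := y) (ε := ε) (by simpa using hε)
  rw [show (-((2 * Real.pi * a : ℝ) : ℂ) * (-(m : ℂ))) = -((2 * Real.pi * a : ℝ) : ℂ) * (((-m : ℝ)) : ℂ) by push_cast; ring]
  exact h

/-- `B`-type height with a NEGATIVE offset `−m`: `‖P·B·e^{κ(−m)}‖·e^{−κy} ≤ ε/((1−q)·2κ)` when `e^{−κ(1−(−m−y))} ≤ ε`. [folklore] -/
theorem heightB_neg_le {a : ℝ} (ha : 0 < a) (β : ℝ) {P : ℂ} (hP : ‖P‖ = 1) {m y ε : ℝ}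
    (hε : Real.exp (-(2 * Real.pi * a) * (1 - (-m - y))) ≤ ε) :
    ‖P * (-(Complex.exp (2 * Real.pi * β * Complex.I) * (Real.exp (-(2 * Real.pi * a)) : ℂ)) /
        ((1 - Complex.exp (2 * Real.pi * β * Complex.I) * (Real.exp (-(2 * Real.pi * a)) : ℂ)) * (2 * (2 * Real.pi * a)))) *
        Complex.exp (((2 * Real.pi * a : ℝ) : ℂ) * (-(m : ℂ)))‖ * Real.exp ((-(2 * Real.pi * a)) * y) ≤
      ε / ((1 - Real.exp (-(2 * Real.pi * a))) * (2 * (2 * Real.pi * a))) := by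
  have h := heightB_le ha β hP (m := -m) (y := y) (ε := ε) (by simpa using hε)
  rw [show (((2 * Real.pi * a : ℝ) : ℂ) * (-(m : ℂ))) = ((2 * Real.pi * a : ℝ) : ℂ) * (((-m : ℝ)) : ℂ) by push_cast; ring]
  exact h

/-- **`twelveTerm_cos_quarter_le`:** the twelve-term `cos` bound at `y₀ = ¼` is at most `0.163 / a ^ 2` for `a ≥ 1`, `ω` in the window. [folklore] -/
theorem twelveTerm_cos_quarter_le {a : ℝ} (ha : 1 ≤ a) (β : ℝ) {ω : ℝ} (hlo : 0.55 * a ≤ ω) (hhi : ω ≤ Real.pi * a / 2 - 399 / 401) :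
    ((‖((1 : ℂ) * (-1 / ((1 - starRingEnd ℂ (Complex.exp (2 * Real.pi * β * Complex.I)) * (Real.exp (-(2 * Real.pi * a)) : ℂ)) * (2 * (2 * Real.pi * a)))) * Complex.exp (-((2 * Real.pi * a : ℝ) : ℂ) * (1 / 4 : ℝ)))‖ * Real.exp ((2 * Real.pi * a) * (-(1 / 4 : ℝ))) * (2 + Real.pi) / |(2 * Real.pi * a)| * (1 / |(Real.pi * a) + (2 * Real.pi * a) * (-(1 / 4 : ℝ)) - ω| + 1 / |(Real.pi * a) + (2 * Real.pi * a) * (-(1 / 4 : ℝ)) + ω|) * (1 / 2) +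
        ‖((1 : ℂ) * (-1 / ((1 - starRingEnd ℂ (Complex.exp (2 * Real.pi * β * Complex.I)) * (Real.exp (-(2 * Real.pi * a)) : ℂ)) * (2 * (2 * Real.pi * a)))) * Complex.exp (-((2 * Real.pi * a : ℝ) : ℂ) * (1 / 4 : ℝ)))‖ * Real.exp ((2 * Real.pi * a) * (-(1 / 2 : ℝ))) * (2 + Real.pi) / |(2 * Real.pi * a)| * (1 / |(Real.pi * a) + (2 * Real.pi * a) * (-(1 / 2 : ℝ)) - ω| + 1 / |(Real.pi * a) + (2 * Real.pi * a) * (-(1 / 2 : ℝ)) + ω|) * (1 / 2)) +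
      (‖((1 : ℂ) * (-(Complex.exp (2 * Real.pi * β * Complex.I) * (Real.exp (-(2 * Real.pi * a)) : ℂ)) / ((1 - Complex.exp (2 * Real.pi * β * Complex.I) * (Real.exp (-(2 * Real.pi * a)) : ℂ)) * (2 * (2 * Real.pi * a)))) * Complex.exp (((2 * Real.pi * a : ℝ) : ℂ) * (1 / 4 : ℝ)))‖ * Real.exp ((-(2 * Real.pi * a)) * (-(1 / 4 : ℝ))) * (2 + Real.pi) / |(-(2 * Real.pi * a))| * (1 / |(Real.pi * a) + (2 * Real.pi * a) * (-(1 / 4 : ℝ)) - ω| + 1 / |(Real.pi * a) + (2 * Real.pi * a) * (-(1 / 4 : ℝ)) + ω|) * (1 / 2) +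
        ‖((1 : ℂ) * (-(Complex.exp (2 * Real.pi * β * Complex.I) * (Real.exp (-(2 * Real.pi * a)) : ℂ)) / ((1 - Complex.exp (2 * Real.pi * β * Complex.I) * (Real.exp (-(2 * Real.pi * a)) : ℂ)) * (2 * (2 * Real.pi * a)))) * Complex.exp (((2 * Real.pi * a : ℝ) : ℂ) * (1 / 4 : ℝ)))‖ * Real.exp ((-(2 * Real.pi * a)) * (-(1 / 2 : ℝ))) * (2 + Real.pi) / |(-(2 * Real.pi * a))| * (1 / |(Real.pi * a) + (2 * Real.pi * a) * (-(1 / 2 : ℝ)) - ω| + 1 / |(Real.pi * a) + (2 * Real.pi * a) * (-(1 / 2 : ℝ)) + ω|) * (1 / 2))) +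
      ((‖((1 : ℂ) * (-1 / ((1 - starRingEnd ℂ (Complex.exp (2 * Real.pi * β * Complex.I)) * (Real.exp (-(2 * Real.pi * a)) : ℂ)) * (2 * (2 * Real.pi * a)))) * Complex.exp (-((2 * Real.pi * a : ℝ) : ℂ) * (1 / 4 : ℝ)))‖ * Real.exp ((2 * Real.pi * a) * (1 / 4 : ℝ)) * (2 + Real.pi) / |(2 * Real.pi * a)| * (1 / |(0 : ℝ) + (-(2 * Real.pi * a)) * (1 / 4 : ℝ) - ω| + 1 / |(0 : ℝ) + (-(2 * Real.pi * a)) * (1 / 4 : ℝ) + ω|) * (1 / 2) +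
        ‖((1 : ℂ) * (-1 / ((1 - starRingEnd ℂ (Complex.exp (2 * Real.pi * β * Complex.I)) * (Real.exp (-(2 * Real.pi * a)) : ℂ)) * (2 * (2 * Real.pi * a)))) * Complex.exp (-((2 * Real.pi * a : ℝ) : ℂ) * (1 / 4 : ℝ)))‖ * Real.exp ((2 * Real.pi * a) * (-(1 / 4 : ℝ))) * (2 + Real.pi) / |(2 * Real.pi * a)| * (1 / |(0 : ℝ) + (-(2 * Real.pi * a)) * (-(1 / 4 : ℝ)) - ω| + 1 / |(0 : ℝ) + (-(2 * Real.pi * a)) * (-(1 / 4 : ℝ)) + ω|) * (1 / 2)) +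
      (‖((1 : ℂ) * (-(Complex.exp (2 * Real.pi * β * Complex.I) * (Real.exp (-(2 * Real.pi * a)) : ℂ)) / ((1 - Complex.exp (2 * Real.pi * β * Complex.I) * (Real.exp (-(2 * Real.pi * a)) : ℂ)) * (2 * (2 * Real.pi * a)))) * Complex.exp (((2 * Real.pi * a : ℝ) : ℂ) * (1 / 4 : ℝ)))‖ * Real.exp ((-(2 * Real.pi * a)) * (1 / 4 : ℝ)) * (2 + Real.pi) / |(-(2 * Real.pi * a))| * (1 / |(0 : ℝ) + (-(2 * Real.pi * a)) * (1 / 4 : ℝ) - ω| + 1 / |(0 : ℝ) + (-(2 * Real.pi * a)) * (1 / 4 : ℝ) + ω|) * (1 / 2) +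
        ‖((1 : ℂ) * (-(Complex.exp (2 * Real.pi * β * Complex.I) * (Real.exp (-(2 * Real.pi * a)) : ℂ)) / ((1 - Complex.exp (2 * Real.pi * β * Complex.I) * (Real.exp (-(2 * Real.pi * a)) : ℂ)) * (2 * (2 * Real.pi * a)))) * Complex.exp (((2 * Real.pi * a : ℝ) : ℂ) * (1 / 4 : ℝ)))‖ * Real.exp ((-(2 * Real.pi * a)) * (-(1 / 4 : ℝ))) * (2 + Real.pi) / |(-(2 * Real.pi * a))| * (1 / |(0 : ℝ) + (-(2 * Real.pi * a)) * (-(1 / 4 : ℝ)) - ω| + 1 / |(0 : ℝ) + (-(2 * Real.pi * a)) * (-(1 / 4 : ℝ)) + ω|) * (1 / 2))) +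
      ((‖((starRingEnd ℂ (Complex.exp (2 * Real.pi * β * Complex.I))) * (-1 / ((1 - starRingEnd ℂ (Complex.exp (2 * Real.pi * β * Complex.I)) * (Real.exp (-(2 * Real.pi * a)) : ℂ)) * (2 * (2 * Real.pi * a)))) * Complex.exp (-((2 * Real.pi * a : ℝ) : ℂ) * (5 / 4 : ℝ)))‖ * Real.exp ((2 * Real.pi * a) * (1 / 2 : ℝ)) * (2 + Real.pi) / |(2 * Real.pi * a)| * (1 / |(-(Real.pi * a)) + (2 * Real.pi * a) * (1 / 2 : ℝ) - ω| + 1 / |(-(Real.pi * a)) + (2 * Real.pi * a) * (1 / 2 : ℝ) + ω|) * (1 / 2) +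
        ‖((starRingEnd ℂ (Complex.exp (2 * Real.pi * β * Complex.I))) * (-1 / ((1 - starRingEnd ℂ (Complex.exp (2 * Real.pi * β * Complex.I)) * (Real.exp (-(2 * Real.pi * a)) : ℂ)) * (2 * (2 * Real.pi * a)))) * Complex.exp (-((2 * Real.pi * a : ℝ) : ℂ) * (5 / 4 : ℝ)))‖ * Real.exp ((2 * Real.pi * a) * (1 / 4 : ℝ)) * (2 + Real.pi) / |(2 * Real.pi * a)| * (1 / |(-(Real.pi * a)) + (2 * Real.pi * a) * (1 / 4 : ℝ) - ω| + 1 / |(-(Real.pi * a)) + (2 * Real.pi * a) * (1 / 4 : ℝ) + ω|) * (1 / 2)) +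
      (‖((starRingEnd ℂ (Complex.exp (2 * Real.pi * β * Complex.I))) * (-(Complex.exp (2 * Real.pi * β * Complex.I) * (Real.exp (-(2 * Real.pi * a)) : ℂ)) / ((1 - Complex.exp (2 * Real.pi * β * Complex.I) * (Real.exp (-(2 * Real.pi * a)) : ℂ)) * (2 * (2 * Real.pi * a)))) * Complex.exp (((2 * Real.pi * a : ℝ) : ℂ) * (5 / 4 : ℝ)))‖ * Real.exp ((-(2 * Real.pi * a)) * (1 / 2 : ℝ)) * (2 + Real.pi) / |(-(2 * Real.pi * a))| * (1 / |(-(Real.pi * a)) + (2 * Real.pi * a) * (1 / 2 : ℝ) - ω| + 1 / |(-(Real.pi * a)) + (2 * Real.pi * a) * (1 / 2 : ℝ) + ω|) * (1 / 2) +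
        ‖((starRingEnd ℂ (Complex.exp (2 * Real.pi * β * Complex.I))) * (-(Complex.exp (2 * Real.pi * β * Complex.I) * (Real.exp (-(2 * Real.pi * a)) : ℂ)) / ((1 - Complex.exp (2 * Real.pi * β * Complex.I) * (Real.exp (-(2 * Real.pi * a)) : ℂ)) * (2 * (2 * Real.pi * a)))) * Complex.exp (((2 * Real.pi * a : ℝ) : ℂ) * (5 / 4 : ℝ)))‖ * Real.exp ((-(2 * Real.pi * a)) * (1 / 4 : ℝ)) * (2 + Real.pi) / |(-(2 * Real.pi * a))| * (1 / |(-(Real.pi * a)) + (2 * Real.pi * a) * (1 / 4 : ℝ) - ω| + 1 / |(-(Real.pi * a)) + (2 * Real.pi * a) * (1 / 4 : ℝ) + ω|) * (1 / 2))) ≤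
      0.163 / a ^ 2 := by
  have ha0 : 0 < a := by linarith
  have hκ : (0 : ℝ) < 2 * Real.pi * a := by positivity
  have hr0 : (0:ℝ) ≤ (1 / 2) := by norm_num
  have t0 : ‖((1 : ℂ) * (-1 / ((1 - starRingEnd ℂ (Complex.exp (2 * Real.pi * β * Complex.I)) * (Real.exp (-(2 * Real.pi * a)) : ℂ)) * (2 * (2 * Real.pi * a)))) * Complex.exp (-((2 * Real.pi * a : ℝ) : ℂ) * (1 / 4 : ℝ)))‖ * Real.exp ((2 * Real.pi * a) * (-(1 / 4 : ℝ))) * (2 + Real.pi) / |(2 * Real.pi * a)| * (1 / |(Real.pi * a) + (2 * Real.pi * a) * (-(1 / 4 : ℝ)) - ω| + 1 / |(Real.pi * a) + (2 * Real.pi * a) * (-(1 / 4 : ℝ)) + ω|) * (1 / 2) ≤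
      (1 / 20) / ((1 - Real.exp (-(2 * Real.pi * a))) * (2 * (2 * Real.pi * a))) * (2 + Real.pi) / (2 * Real.pi * a) * 1.48 * (1 / 2) :=
    term_le_of (norm_nonneg _) (Real.exp_pos _).le (heightA_le ha0 β norm_one (by rw [show ((1 / 4 : ℝ) - (-(1 / 4 : ℝ))) = (1/2:ℝ) by norm_num]; exact exp_neg_kappa_half_le ha)) (abs_of_pos hκ) hκ (by positivity) (by rw [show (Real.pi * a) + (2 * Real.pi * a) * (-(1 / 4 : ℝ)) = Real.pi * a / 2 by ring]; exact detune_pos_le ha hlo hhi) hr0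
  have g0 := t0.trans (termBound_le ha (ε := (1 / 20)) (D := 1.48) (r := (1 / 2)) (by norm_num) (by norm_num) hr0)
  have t1 : ‖((1 : ℂ) * (-1 / ((1 - starRingEnd ℂ (Complex.exp (2 * Real.pi * β * Complex.I)) * (Real.exp (-(2 * Real.pi * a)) : ℂ)) * (2 * (2 * Real.pi * a)))) * Complex.exp (-((2 * Real.pi * a : ℝ) : ℂ) * (1 / 4 : ℝ)))‖ * Real.exp ((2 * Real.pi * a) * (-(1 / 2 : ℝ))) * (2 + Real.pi) / |(2 * Real.pi * a)| * (1 / |(Real.pi * a) + (2 * Real.pi * a) * (-(1 / 2 : ℝ)) - ω| + 1 / |(Real.pi * a) + (2 * Real.pi * a) * (-(1 / 2 : ℝ)) + ω|) * (1 / 2) ≤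
      0.0112 / ((1 - Real.exp (-(2 * Real.pi * a))) * (2 * (2 * Real.pi * a))) * (2 + Real.pi) / (2 * Real.pi * a) * (40 / 11) * (1 / 2) :=
    term_le_of (norm_nonneg _) (Real.exp_pos _).le (heightA_le ha0 β norm_one (by rw [show ((1 / 4 : ℝ) - (-(1 / 2 : ℝ))) = (3/4:ℝ) by norm_num]; exact exp_neg_kappa_threeQuarter_le ha)) (abs_of_pos hκ) hκ (by positivity) (by rw [show (Real.pi * a) + (2 * Real.pi * a) * (-(1 / 2 : ℝ)) = (0:ℝ) by ring]; exact detune_zero_le' ha hlo) hr0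
  have g1 := t1.trans (termBound_le ha (ε := 0.0112) (D := (40 / 11)) (r := (1 / 2)) (by norm_num) (by norm_num) hr0)
  have t2 : ‖((1 : ℂ) * (-(Complex.exp (2 * Real.pi * β * Complex.I) * (Real.exp (-(2 * Real.pi * a)) : ℂ)) / ((1 - Complex.exp (2 * Real.pi * β * Complex.I) * (Real.exp (-(2 * Real.pi * a)) : ℂ)) * (2 * (2 * Real.pi * a)))) * Complex.exp (((2 * Real.pi * a : ℝ) : ℂ) * (1 / 4 : ℝ)))‖ * Real.exp ((-(2 * Real.pi * a)) * (-(1 / 4 : ℝ))) * (2 + Real.pi) / |(-(2 * Real.pi * a))| * (1 / |(Real.pi * a) + (2 * Real.pi * a) * (-(1 / 4 : ℝ)) - ω| + 1 / |(Real.pi * a) + (2 * Real.pi * a) * (-(1 / 4 : ℝ)) + ω|) * (1 / 2) ≤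
      (1 / 20) / ((1 - Real.exp (-(2 * Real.pi * a))) * (2 * (2 * Real.pi * a))) * (2 + Real.pi) / (2 * Real.pi * a) * 1.48 * (1 / 2) :=
    term_le_of (norm_nonneg _) (Real.exp_pos _).le (heightB_le ha0 β norm_one (by rw [show (1 - ((1 / 4 : ℝ) - (-(1 / 4 : ℝ)))) = (1/2:ℝ) by norm_num]; exact exp_neg_kappa_half_le ha)) (by rw [abs_neg, abs_of_pos hκ]) hκ (by positivity) (by rw [show (Real.pi * a) + (2 * Real.pi * a) * (-(1 / 4 : ℝ)) = Real.pi * a / 2 by ring]; exact detune_pos_le ha hlo hhi) hr0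
  have g2 := t2.trans (termBound_le ha (ε := (1 / 20)) (D := 1.48) (r := (1 / 2)) (by norm_num) (by norm_num) hr0)
  have t3 : ‖((1 : ℂ) * (-(Complex.exp (2 * Real.pi * β * Complex.I) * (Real.exp (-(2 * Real.pi * a)) : ℂ)) / ((1 - Complex.exp (2 * Real.pi * β * Complex.I) * (Real.exp (-(2 * Real.pi * a)) : ℂ)) * (2 * (2 * Real.pi * a)))) * Complex.exp (((2 * Real.pi * a : ℝ) : ℂ) * (1 / 4 : ℝ)))‖ * Real.exp ((-(2 * Real.pi * a)) * (-(1 / 2 : ℝ))) * (2 + Real.pi) / |(-(2 * Real.pi * a))| * (1 / |(Real.pi * a) + (2 * Real.pi * a) * (-(1 / 2 : ℝ)) - ω| + 1 / |(Real.pi * a) + (2 * Real.pi * a) * (-(1 / 2 : ℝ)) + ω|) * (1 / 2) ≤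
      0.2237 / ((1 - Real.exp (-(2 * Real.pi * a))) * (2 * (2 * Real.pi * a))) * (2 + Real.pi) / (2 * Real.pi * a) * (40 / 11) * (1 / 2) :=
    term_le_of (norm_nonneg _) (Real.exp_pos _).le (heightB_le ha0 β norm_one (by rw [show (1 - ((1 / 4 : ℝ) - (-(1 / 2 : ℝ)))) = (1/4:ℝ) by norm_num]; exact exp_neg_kappa_quarter_le ha)) (by rw [abs_neg, abs_of_pos hκ]) hκ (by positivity) (by rw [show (Real.pi * a) + (2 * Real.pi * a) * (-(1 / 2 : ℝ)) = (0:ℝ) by ring]; exact detune_zero_le' ha hlo) hr0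
  have g3 := t3.trans (termBound_le ha (ε := 0.2237) (D := (40 / 11)) (r := (1 / 2)) (by norm_num) (by norm_num) hr0)
  have t4 : ‖((1 : ℂ) * (-1 / ((1 - starRingEnd ℂ (Complex.exp (2 * Real.pi * β * Complex.I)) * (Real.exp (-(2 * Real.pi * a)) : ℂ)) * (2 * (2 * Real.pi * a)))) * Complex.exp (-((2 * Real.pi * a : ℝ) : ℂ) * (1 / 4 : ℝ)))‖ * Real.exp ((2 * Real.pi * a) * (1 / 4 : ℝ)) * (2 + Real.pi) / |(2 * Real.pi * a)| * (1 / |(0 : ℝ) + (-(2 * Real.pi * a)) * (1 / 4 : ℝ) - ω| + 1 / |(0 : ℝ) + (-(2 * Real.pi * a)) * (1 / 4 : ℝ) + ω|) * (1 / 2) ≤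
      1 / ((1 - Real.exp (-(2 * Real.pi * a))) * (2 * (2 * Real.pi * a))) * (2 + Real.pi) / (2 * Real.pi * a) * 1.48 * (1 / 2) :=
    term_le_of (norm_nonneg _) (Real.exp_pos _).le (heightA_le ha0 β norm_one (le_of_eq (by rw [show ((1 / 4 : ℝ) - (1 / 4 : ℝ)) = (0:ℝ) by norm_num, mul_zero, Real.exp_zero]))) (abs_of_pos hκ) hκ (by positivity) (by rw [show (0 : ℝ) + (-(2 * Real.pi * a)) * (1 / 4 : ℝ) = -(Real.pi * a / 2) by ring]; exact detune_neg_le ha hlo hhi) hr0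
  have g4 := t4.trans (termBound_le ha (ε := 1) (D := 1.48) (r := (1 / 2)) (by norm_num) (by norm_num) hr0)
  have t5 : ‖((1 : ℂ) * (-1 / ((1 - starRingEnd ℂ (Complex.exp (2 * Real.pi * β * Complex.I)) * (Real.exp (-(2 * Real.pi * a)) : ℂ)) * (2 * (2 * Real.pi * a)))) * Complex.exp (-((2 * Real.pi * a : ℝ) : ℂ) * (1 / 4 : ℝ)))‖ * Real.exp ((2 * Real.pi * a) * (-(1 / 4 : ℝ))) * (2 + Real.pi) / |(2 * Real.pi * a)| * (1 / |(0 : ℝ) + (-(2 * Real.pi * a)) * (-(1 / 4 : ℝ)) - ω| + 1 / |(0 : ℝ) + (-(2 * Real.pi * a)) * (-(1 / 4 : ℝ)) + ω|) * (1 / 2) ≤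
      (1 / 20) / ((1 - Real.exp (-(2 * Real.pi * a))) * (2 * (2 * Real.pi * a))) * (2 + Real.pi) / (2 * Real.pi * a) * 1.48 * (1 / 2) :=
    term_le_of (norm_nonneg _) (Real.exp_pos _).le (heightA_le ha0 β norm_one (by rw [show ((1 / 4 : ℝ) - (-(1 / 4 : ℝ))) = (1/2:ℝ) by norm_num]; exact exp_neg_kappa_half_le ha)) (abs_of_pos hκ) hκ (by positivity) (by rw [show (0 : ℝ) + (-(2 * Real.pi * a)) * (-(1 / 4 : ℝ)) = Real.pi * a / 2 by ring]; exact detune_pos_le ha hlo hhi) hr0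
  have g5 := t5.trans (termBound_le ha (ε := (1 / 20)) (D := 1.48) (r := (1 / 2)) (by norm_num) (by norm_num) hr0)
  have t6 : ‖((1 : ℂ) * (-(Complex.exp (2 * Real.pi * β * Complex.I) * (Real.exp (-(2 * Real.pi * a)) : ℂ)) / ((1 - Complex.exp (2 * Real.pi * β * Complex.I) * (Real.exp (-(2 * Real.pi * a)) : ℂ)) * (2 * (2 * Real.pi * a)))) * Complex.exp (((2 * Real.pi * a : ℝ) : ℂ) * (1 / 4 : ℝ)))‖ * Real.exp ((-(2 * Real.pi * a)) * (1 / 4 : ℝ)) * (2 + Real.pi) / |(-(2 * Real.pi * a))| * (1 / |(0 : ℝ) + (-(2 * Real.pi * a)) * (1 / 4 : ℝ) - ω| + 1 / |(0 : ℝ) + (-(2 * Real.pi * a)) * (1 / 4 : ℝ) + ω|) * (1 / 2) ≤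
      (1 / 400) / ((1 - Real.exp (-(2 * Real.pi * a))) * (2 * (2 * Real.pi * a))) * (2 + Real.pi) / (2 * Real.pi * a) * 1.48 * (1 / 2) :=
    term_le_of (norm_nonneg _) (Real.exp_pos _).le (heightB_le ha0 β norm_one (by rw [show (1 - ((1 / 4 : ℝ) - (1 / 4 : ℝ))) = (1:ℝ) by norm_num, mul_one]; exact exp_neg_kappa_le ha)) (by rw [abs_neg, abs_of_pos hκ]) hκ (by positivity) (by rw [show (0 : ℝ) + (-(2 * Real.pi * a)) * (1 / 4 : ℝ) = -(Real.pi * a / 2) by ring]; exact detune_neg_le ha hlo hhi) hr0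
  have g6 := t6.trans (termBound_le ha (ε := (1 / 400)) (D := 1.48) (r := (1 / 2)) (by norm_num) (by norm_num) hr0)
  have t7 : ‖((1 : ℂ) * (-(Complex.exp (2 * Real.pi * β * Complex.I) * (Real.exp (-(2 * Real.pi * a)) : ℂ)) / ((1 - Complex.exp (2 * Real.pi * β * Complex.I) * (Real.exp (-(2 * Real.pi * a)) : ℂ)) * (2 * (2 * Real.pi * a)))) * Complex.exp (((2 * Real.pi * a : ℝ) : ℂ) * (1 / 4 : ℝ)))‖ * Real.exp ((-(2 * Real.pi * a)) * (-(1 / 4 : ℝ))) * (2 + Real.pi) / |(-(2 * Real.pi * a))| * (1 / |(0 : ℝ) + (-(2 * Real.pi * a)) * (-(1 / 4 : ℝ)) - ω| + 1 / |(0 : ℝ) + (-(2 * Real.pi * a)) * (-(1 / 4 : ℝ)) + ω|) * (1 / 2) ≤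
      (1 / 20) / ((1 - Real.exp (-(2 * Real.pi * a))) * (2 * (2 * Real.pi * a))) * (2 + Real.pi) / (2 * Real.pi * a) * 1.48 * (1 / 2) :=
    term_le_of (norm_nonneg _) (Real.exp_pos _).le (heightB_le ha0 β norm_one (by rw [show (1 - ((1 / 4 : ℝ) - (-(1 / 4 : ℝ)))) = (1/2:ℝ) by norm_num]; exact exp_neg_kappa_half_le ha)) (by rw [abs_neg, abs_of_pos hκ]) hκ (by positivity) (by rw [show (0 : ℝ) + (-(2 * Real.pi * a)) * (-(1 / 4 : ℝ)) = Real.pi * a / 2 by ring]; exact detune_pos_le ha hlo hhi) hr0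
  have g7 := t7.trans (termBound_le ha (ε := (1 / 20)) (D := 1.48) (r := (1 / 2)) (by norm_num) (by norm_num) hr0)
  have t8 : ‖((starRingEnd ℂ (Complex.exp (2 * Real.pi * β * Complex.I))) * (-1 / ((1 - starRingEnd ℂ (Complex.exp (2 * Real.pi * β * Complex.I)) * (Real.exp (-(2 * Real.pi * a)) : ℂ)) * (2 * (2 * Real.pi * a)))) * Complex.exp (-((2 * Real.pi * a : ℝ) : ℂ) * (5 / 4 : ℝ)))‖ * Real.exp ((2 * Real.pi * a) * (1 / 2 : ℝ)) * (2 + Real.pi) / |(2 * Real.pi * a)| * (1 / |(-(Real.pi * a)) + (2 * Real.pi * a) * (1 / 2 : ℝ) - ω| + 1 / |(-(Real.pi * a)) + (2 * Real.pi * a) * (1 / 2 : ℝ) + ω|) * (1 / 2) ≤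
      0.0112 / ((1 - Real.exp (-(2 * Real.pi * a))) * (2 * (2 * Real.pi * a))) * (2 + Real.pi) / (2 * Real.pi * a) * (40 / 11) * (1 / 2) :=
    term_le_of (norm_nonneg _) (Real.exp_pos _).le (heightA_le ha0 β (norm_pref_conj β) (by rw [show ((5 / 4 : ℝ) - (1 / 2 : ℝ)) = (3/4:ℝ) by norm_num]; exact exp_neg_kappa_threeQuarter_le ha)) (abs_of_pos hκ) hκ (by positivity) (by rw [show (-(Real.pi * a)) + (2 * Real.pi * a) * (1 / 2 : ℝ) = (0:ℝ) by ring]; exact detune_zero_le' ha hlo) hr0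
  have g8 := t8.trans (termBound_le ha (ε := 0.0112) (D := (40 / 11)) (r := (1 / 2)) (by norm_num) (by norm_num) hr0)
  have t9 : ‖((starRingEnd ℂ (Complex.exp (2 * Real.pi * β * Complex.I))) * (-1 / ((1 - starRingEnd ℂ (Complex.exp (2 * Real.pi * β * Complex.I)) * (Real.exp (-(2 * Real.pi * a)) : ℂ)) * (2 * (2 * Real.pi * a)))) * Complex.exp (-((2 * Real.pi * a : ℝ) : ℂ) * (5 / 4 : ℝ)))‖ * Real.exp ((2 * Real.pi * a) * (1 / 4 : ℝ)) * (2 + Real.pi) / |(2 * Real.pi * a)| * (1 / |(-(Real.pi * a)) + (2 * Real.pi * a) * (1 / 4 : ℝ) - ω| + 1 / |(-(Real.pi * a)) + (2 * Real.pi * a) * (1 / 4 : ℝ) + ω|) * (1 / 2) ≤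
      (1 / 400) / ((1 - Real.exp (-(2 * Real.pi * a))) * (2 * (2 * Real.pi * a))) * (2 + Real.pi) / (2 * Real.pi * a) * 1.48 * (1 / 2) :=
    term_le_of (norm_nonneg _) (Real.exp_pos _).le (heightA_le ha0 β (norm_pref_conj β) (by rw [show ((5 / 4 : ℝ) - (1 / 4 : ℝ)) = (1:ℝ) by norm_num, mul_one]; exact exp_neg_kappa_le ha)) (abs_of_pos hκ) hκ (by positivity) (by rw [show (-(Real.pi * a)) + (2 * Real.pi * a) * (1 / 4 : ℝ) = -(Real.pi * a / 2) by ring]; exact detune_neg_le ha hlo hhi) hr0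
  have g9 := t9.trans (termBound_le ha (ε := (1 / 400)) (D := 1.48) (r := (1 / 2)) (by norm_num) (by norm_num) hr0)
  have t10 : ‖((starRingEnd ℂ (Complex.exp (2 * Real.pi * β * Complex.I))) * (-(Complex.exp (2 * Real.pi * β * Complex.I) * (Real.exp (-(2 * Real.pi * a)) : ℂ)) / ((1 - Complex.exp (2 * Real.pi * β * Complex.I) * (Real.exp (-(2 * Real.pi * a)) : ℂ)) * (2 * (2 * Real.pi * a)))) * Complex.exp (((2 * Real.pi * a : ℝ) : ℂ) * (5 / 4 : ℝ)))‖ * Real.exp ((-(2 * Real.pi * a)) * (1 / 2 : ℝ)) * (2 + Real.pi) / |(-(2 * Real.pi * a))| * (1 / |(-(Real.pi * a)) + (2 * Real.pi * a) * (1 / 2 : ℝ) - ω| + 1 / |(-(Real.pi * a)) + (2 * Real.pi * a) * (1 / 2 : ℝ) + ω|) * (1 / 2) ≤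
      0.2237 / ((1 - Real.exp (-(2 * Real.pi * a))) * (2 * (2 * Real.pi * a))) * (2 + Real.pi) / (2 * Real.pi * a) * (40 / 11) * (1 / 2) :=
    term_le_of (norm_nonneg _) (Real.exp_pos _).le (heightB_le ha0 β (norm_pref_conj β) (by rw [show (1 - ((5 / 4 : ℝ) - (1 / 2 : ℝ))) = (1/4:ℝ) by norm_num]; exact exp_neg_kappa_quarter_le ha)) (by rw [abs_neg, abs_of_pos hκ]) hκ (by positivity) (by rw [show (-(Real.pi * a)) + (2 * Real.pi * a) * (1 / 2 : ℝ) = (0:ℝ) by ring]; exact detune_zero_le' ha hlo) hr0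
  have g10 := t10.trans (termBound_le ha (ε := 0.2237) (D := (40 / 11)) (r := (1 / 2)) (by norm_num) (by norm_num) hr0)
  have t11 : ‖((starRingEnd ℂ (Complex.exp (2 * Real.pi * β * Complex.I))) * (-(Complex.exp (2 * Real.pi * β * Complex.I) * (Real.exp (-(2 * Real.pi * a)) : ℂ)) / ((1 - Complex.exp (2 * Real.pi * β * Complex.I) * (Real.exp (-(2 * Real.pi * a)) : ℂ)) * (2 * (2 * Real.pi * a)))) * Complex.exp (((2 * Real.pi * a : ℝ) : ℂ) * (5 / 4 : ℝ)))‖ * Real.exp ((-(2 * Real.pi * a)) * (1 / 4 : ℝ)) * (2 + Real.pi) / |(-(2 * Real.pi * a))| * (1 / |(-(Real.pi * a)) + (2 * Real.pi * a) * (1 / 4 : ℝ) - ω| + 1 / |(-(Real.pi * a)) + (2 * Real.pi * a) * (1 / 4 : ℝ) + ω|) * (1 / 2) ≤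
      1 / ((1 - Real.exp (-(2 * Real.pi * a))) * (2 * (2 * Real.pi * a))) * (2 + Real.pi) / (2 * Real.pi * a) * 1.48 * (1 / 2) :=
    term_le_of (norm_nonneg _) (Real.exp_pos _).le (heightB_le ha0 β (norm_pref_conj β) (le_of_eq (by rw [show (1 - ((5 / 4 : ℝ) - (1 / 4 : ℝ))) = (0:ℝ) by norm_num, mul_zero, Real.exp_zero]))) (by rw [abs_neg, abs_of_pos hκ]) hκ (by positivity) (by rw [show (-(Real.pi * a)) + (2 * Real.pi * a) * (1 / 4 : ℝ) = -(Real.pi * a / 2) by ring]; exact detune_neg_le ha hlo hhi) hr0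
  have g11 := t11.trans (termBound_le ha (ε := 1) (D := 1.48) (r := (1 / 2)) (by norm_num) (by norm_num) hr0)
  have hsum := add_le_add (add_le_add (add_le_add (add_le_add g0 g1) (add_le_add g2 g3)) (add_le_add (add_le_add g4 g5) (add_le_add g6 g7)))
    (add_le_add (add_le_add g8 g9) (add_le_add g10 g11))
  refine hsum.trans ?_
  have hfin : (0 : ℝ) < a ^ 2 := by positivity
  rw [← add_div, ← add_div, ← add_div, ← add_div, ← add_div, ← add_div, ← add_div, ← add_div, ← add_div, ← add_div, ← add_div]
  exact div_le_div_of_nonneg_right (by norm_num) hfin.le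

end Summit.AnomalousDissipation.AnomalousDissipation.Theorems.SawtoothPulseCascade.K2PhaseBudget

end
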